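import Mathlib.Analysis.SpecialFunctions.Log.Basic
import Mathlib.Analysis.SpecialFunctions.Exp
import Mathlib.Algebra.Order.Floor.Defs
import Mathlib.Algebra.Order.Floor.Semiring
import HarnessLib

/-!
# Pure-ℝ bookkeeping of the kinetic log-heart reduction (crux `LambertianEuler`, stmt-AtomisticToContinuum-11854, line `Sketch`, sub-goals `eps_threshold_gauss`, `window_count`)

Two elementary real-arithmetic facts used when the kinetic log-heart of the Lambertian gas is
reduced to its two research inputs.

* `eps_threshold_gauss` — with the clamp level `V(ε) := c₀ κ |log ε|` (`a, c₀, κ > 0`, `P ≥ 0`) there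
  is a threshold `0 < ε₀ ≤ 1/2` such that for every `0 < ε < ε₀` one has `V(ε) ≥ 1` and the
  Gaussian-tail remainder is negligible: `P · exp (−a V(ε)²) ≤ ε / 3`.  Proof: with `Q := 3P + 3`,
  `b := c₀ κ` and `Lmin := max 1 (max (1/b) ((1 + |log Q|) / (a b²)))` take
  `ε₀ := min (1/2) (exp (−Lmin))`; then `L := |log ε| = −log ε > Lmin`, so `b L ≥ 1` and
  `a (b L)² ≥ L (1 + |log Q|) ≥ L + |log Q|`, whence `exp (−a (b L)²) ≤ exp (log ε − log Q) = ε / Q`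
  and `P ε / Q ≤ ε / 3`.
* `window_count` — a length `L ≥ h₀ > 0` splits into `m ≥ 1` equal windows of length
  `L / m ∈ [h₀, 2 h₀]`: take `m := ⌊L / h₀⌋₊`.

Only Mathlib is used (`Real.log_lt_log`, `Real.log_exp`, `Real.exp_sub`, `Real.exp_log`,
`Nat.le_floor`, `Nat.floor_le`, `Nat.lt_floor_add_one`).
-/

noncomputable section

namespace Summit.AtomisticToContinuum.HydrodynamicLimit.Theorems.LambertianContactSwapLambertianEulerKineticArith

/-- **Gaussian-tail threshold for the clamp level.** For `a, c₀, κ > 0` and `P ≥ 0` there is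
`0 < ε₀ ≤ 1/2` such that for all `0 < ε < ε₀` the clamp level `V(ε) = c₀ κ |log ε|` satisfies
`V(ε) ≥ 1` and `P · exp (−a V(ε)²) ≤ ε / 3`. [folklore] -/
theorem eps_threshold_gauss : ∀ {a c₀ κ P : ℝ}, 0 < a → 0 < c₀ → 0 < κ → 0 ≤ P → ∃ ε₀ : ℝ, 0 < ε₀ ∧ ε₀ ≤ 1 / 2 ∧ ∀ ε : ℝ, 0 < ε → ε < ε₀ → 1 ≤ c₀ * κ * |Real.log ε| ∧ P * Real.exp (-(a * (c₀ * κ * |Real.log ε|) ^ 2)) ≤ ε / 3 := by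
  intro a c₀ κ P ha hc₀ hκ hP
  -- the comparison constant `Q = 3P + 3` and the product `b = c₀ κ`
  obtain ⟨Q, hQdef⟩ : ∃ Q : ℝ, Q = 3 * P + 3 := ⟨_, rfl⟩
  have hQ : 0 < Q := by rw [hQdef]; linarith
  have hb : 0 < c₀ * κ := mul_pos hc₀ hκ
  have hab : 0 < a * (c₀ * κ) ^ 2 := by positivity
  -- the minimal size `Lmin` of `|log ε|`
  obtain ⟨Lmin, hLmin⟩ : ∃ Lmin : ℝ,
      Lmin = max 1 (max (1 / (c₀ * κ)) ((1 + |Real.log Q|) / (a * (c₀ * κ) ^ 2))) := ⟨_, rfl⟩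
  have hLmin1 : (1 : ℝ) ≤ Lmin := by rw [hLmin]; exact le_max_left _ _
  have hLminb : 1 / (c₀ * κ) ≤ Lmin := by
    rw [hLmin]; exact (le_max_left _ _).trans (le_max_right _ _)
  have hLminQ : (1 + |Real.log Q|) / (a * (c₀ * κ) ^ 2) ≤ Lmin := by
    rw [hLmin]; exact (le_max_right _ _).trans (le_max_right _ _)
  refine ⟨min (1 / 2) (Real.exp (-Lmin)), lt_min (by norm_num) (Real.exp_pos _), min_le_left _ _, ?_⟩
  intro ε hε hεlt
  have hε1 : ε < Real.exp (-Lmin) := hεlt.trans_le (min_le_right _ _)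
  -- `log ε < -Lmin`, so `L := -log ε = |log ε|` exceeds `Lmin`
  have hlog : Real.log ε < -Lmin := by
    have := Real.log_lt_log hε hε1
    rwa [Real.log_exp] at this
  have hL1 : 1 ≤ -Real.log ε := by linarith
  have hL0 : 0 ≤ -Real.log ε := by linarith
  have hLb : 1 / (c₀ * κ) ≤ -Real.log ε := by linarith
  have hLQ : (1 + |Real.log Q|) / (a * (c₀ * κ) ^ 2) ≤ -Real.log ε := by linarith
  have habs : |Real.log ε| = -Real.log ε := abs_of_neg (by linarith)
  rw [habs]
  refine ⟨?_, ?_⟩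
  · -- `b L ≥ b · (1/b) = 1`
    calc (1 : ℝ) ≤ -Real.log ε * (c₀ * κ) := (div_le_iff₀ hb).1 hLb
      _ = c₀ * κ * -Real.log ε := by ring
  · -- the Gaussian tail: `a (b L)² ≥ L + |log Q|`
    have h1 : 1 + |Real.log Q| ≤ -Real.log ε * (a * (c₀ * κ) ^ 2) := (div_le_iff₀ hab).1 hLQ
    have h2 : -Real.log ε + |Real.log Q| ≤ a * (c₀ * κ * -Real.log ε) ^ 2 := by
      have h3 : (1 + |Real.log Q|) * -Real.log ε ≤ -Real.log ε * (a * (c₀ * κ) ^ 2) * -Real.log ε :=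
        mul_le_mul_of_nonneg_right h1 hL0
      have h4 : 0 ≤ |Real.log Q| * (-Real.log ε - 1) := mul_nonneg (abs_nonneg _) (by linarith)
      nlinarith [h3, h4]
    -- hence `exp (−a (b L)²) ≤ exp (log ε − log Q) = ε / Q`
    have hexp : Real.exp (-(a * (c₀ * κ * -Real.log ε) ^ 2)) ≤ ε / Q := by
      have h5 : -(a * (c₀ * κ * -Real.log ε) ^ 2) ≤ Real.log ε - Real.log Q := by
        have := le_abs_self (Real.log Q)
        linarith
      calc Real.exp (-(a * (c₀ * κ * -Real.log ε) ^ 2))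
          ≤ Real.exp (Real.log ε - Real.log Q) := Real.exp_le_exp.2 h5
        _ = ε / Q := by rw [Real.exp_sub, Real.exp_log hε, Real.exp_log hQ]
    -- and `P ε / Q ≤ ε / 3` because `3 P ≤ Q`
    have hPQ : P / Q ≤ 1 / 3 := by
      rw [div_le_iff₀ hQ, hQdef]
      linarith
    calc P * Real.exp (-(a * (c₀ * κ * -Real.log ε) ^ 2))
        ≤ P * (ε / Q) := mul_le_mul_of_nonneg_left hexp hP
      _ = P / Q * ε := by ring
      _ ≤ 1 / 3 * ε := mul_le_mul_of_nonneg_right hPQ hε.le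
      _ = ε / 3 := by ring

/-- **Window count.** A length `L ≥ h₀ > 0` is covered by `m ≥ 1` equal windows of length `L / m`
with `h₀ ≤ L / m ≤ 2 h₀` (take `m = ⌊L / h₀⌋₊`). [folklore] -/
theorem window_count : ∀ {L h₀ : ℝ}, 0 < h₀ → h₀ ≤ L → ∃ m : ℕ, 1 ≤ m ∧ h₀ ≤ L / m ∧ L / m ≤ 2 * h₀ := by
  intro L h₀ hh₀ hhL
  have hq1 : 1 ≤ L / h₀ := by rwa [le_div_iff₀ hh₀, one_mul]
  have hq0 : 0 ≤ L / h₀ := zero_le_one.trans hq1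
  have hm1 : 1 ≤ ⌊L / h₀⌋₊ := Nat.le_floor (by exact_mod_cast hq1)
  have hm1' : (1 : ℝ) ≤ (⌊L / h₀⌋₊ : ℝ) := by exact_mod_cast hm1
  have hmpos : (0 : ℝ) < (⌊L / h₀⌋₊ : ℝ) := zero_lt_one.trans_le hm1'
  refine ⟨⌊L / h₀⌋₊, hm1, ?_, ?_⟩
  · -- `m h₀ ≤ L`
    rw [le_div_iff₀ hmpos]
    have h1 : (⌊L / h₀⌋₊ : ℝ) ≤ L / h₀ := Nat.floor_le hq0
    rw [le_div_iff₀ hh₀] at h1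
    linarith [mul_comm h₀ (⌊L / h₀⌋₊ : ℝ)]
  · -- `L < (m + 1) h₀ ≤ 2 m h₀`
    rw [div_le_iff₀ hmpos]
    have h2 : L / h₀ < (⌊L / h₀⌋₊ : ℝ) + 1 := Nat.lt_floor_add_one _
    rw [div_lt_iff₀ hh₀] at h2
    nlinarith [mul_le_mul_of_nonneg_right hm1' hh₀.le]

end Summit.AtomisticToContinuum.HydrodynamicLimit.Theorems.LambertianContactSwapLambertianEulerKineticArith

end
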